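import Summits.CriticalPhenomena.PercolationContinuityZ3.Theses.PercNonProliferation
import Summits.CriticalPhenomena.PercolationContinuityZ3.Theorems.PercNonProliferationAssembly
import Summits.CriticalPhenomena.PercolationContinuityZ3.Theorems.PercNonProliferationSpanningPiecesCount
import Summits.CriticalPhenomena.PercolationContinuityZ3.Theorems.PercNonProliferationDensityWhp
import Summits.CriticalPhenomena.PercolationContinuityZ3.Theorems.PercShatteringRaceRaceLemma
import Literature.Probability.Percolation.HalfSpacePinnedPairs
import Literature.Probability.Percolation.PercolationProofs
import Literature.Probability.Percolation.ConnectivityProofs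
import Literature.Probability.Percolation.SharpnessDCTProofs
import HarnessLib

/-!
# Crux `PercNonProliferation.NonProliferation` (stmt-CriticalPhenomena-4444), line `jump-fragmentation` —
# the route consumes the load-bearing stub S1 at ANY fixed aspect ratio

Lead c8 of line `jump-fragmentation`. Lands with `--supports stmt-CriticalPhenomena-4444`; closes nothing by itself;
no definitions.

`continuity_of_freeBoxSparse_of_fewClasses` (landed, `…FewClasses.lean`) re-glues the route's deciding theorem on
S1 = "few `B(2n)`-classes of percolating points of `B(n)`" at aspect ratio `2`. The density count is scale-agnostic
(`nonProlifAssembly_abstract`), so the same proof runs at every fixed ratio `k ≥ 1`, with `FreeBoxSparse` read at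
index `k n` and `|B(k n)|² ≤ k⁶ |B(n)|²` in place of `64`:

* `continuity_of_freeBoxSparse_of_fewClassesRatio` — **`FreeBoxSparse →` S1(ratio `k`) `→ θ(p_c(ℤ³)) = 0`** for
  the hypothesis `∃ k M c, 1 ≤ k ∧ 0 < c ∧ ∃ᶠ n, P_{p_c}(no M+1 percolating points of B(n) pairwise unjoined
  inside B(k n)) ≥ c`.

Since being unjoined inside a LARGER box is harder, S1(ratio `k`) weakens as `k` grows (it is implied by the
registered ratio-2 stub for every `k ≥ 2`, `fewClassesRatio_of_fewClasses`); this file records that the route can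
consume the weakest member of the family, i.e. the planner may file S1 at any fixed ratio (memo B of the crux
NOTES: "the assembly runs at any fixed aspect ratio"). By `…FewClassesRatioFree.lean` the ratio cannot be dropped
altogether for free only in the sense that uniqueness gives an `n`-dependent outer scale; a fixed ratio is genuine
content (same-`p` local uniqueness, barrier `SprinklingRenormalisation`).
-/

noncomputable section

namespace Summit.CriticalPhenomena.PercolationContinuityZ3.Theorems.NonProliferation

open MeasureTheory Filter Topology
open Literature.Probability.LatticeModels Literature.Probability.Percolation
open Summit.CriticalPhenomena.PercolationContinuityZ3.Theses.PercNonProliferation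
open Summit.CriticalPhenomena.PercolationContinuityZ3.Theorems

/-- `|B(k n)|² ≤ k⁶ |B(n)|²` for `k ≥ 1` (`(2kn+1) ≤ k(2n+1)`). [folklore] -/
theorem card_box_mul_sq_le {k : ℕ} (hk : 1 ≤ k) (n : ℕ) :
    ((box 3 (k * n)).card : ℝ) ^ 2 ≤ (k : ℝ) ^ 6 * ((box 3 n).card : ℝ) ^ 2 := by
  have h8 : ((box 3 (k * n)).card : ℝ) ≤ (k : ℝ) ^ 3 * (box 3 n).card := by
    rw [card_box, card_box]
    have h : (2 * (k * n) + 1) ^ 3 ≤ k ^ 3 * (2 * n + 1) ^ 3 := by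
      calc (2 * (k * n) + 1) ^ 3 ≤ (k * (2 * n + 1)) ^ 3 := Nat.pow_le_pow_left (by nlinarith) 3
        _ = k ^ 3 * (2 * n + 1) ^ 3 := by ring
    exact_mod_cast h
  calc ((box 3 (k * n)).card : ℝ) ^ 2 ≤ ((k : ℝ) ^ 3 * ((box 3 n).card : ℝ)) ^ 2 :=
        pow_le_pow_left₀ (Nat.cast_nonneg _) h8 2
    _ = (k : ℝ) ^ 6 * ((box 3 n).card : ℝ) ^ 2 := by ring

/-- S1 at ratio `2` (the registered stub) implies S1 at every ratio `k ≥ 2` (a larger outer box only helps). -/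
theorem fewClassesRatio_of_fewClasses
    (hS1 : ∃ (M : ℕ) (c : ℝ), 0 < c ∧ ∃ᶠ n : ℕ in atTop, c ≤ (bondPercolation (zdGraph 3) (criticalProbI 3)).real
      {ω | ¬ ∃ x : Fin (M + 1) → Site 3, (∀ i, x i ∈ box 3 n) ∧ (∀ i, ω ∈ percolatesAt (x i)) ∧
        ∀ i j, i ≠ j → ω ∉ openConnIn (↑(box 3 (2 * n)) : Set (Site 3)) (x i) (x j)})
    {k : ℕ} (hk : 2 ≤ k) :
    ∃ (M : ℕ) (c : ℝ), 0 < c ∧ ∃ᶠ n : ℕ in atTop, c ≤ (bondPercolation (zdGraph 3) (criticalProbI 3)).real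
      {ω | ¬ ∃ x : Fin (M + 1) → Site 3, (∀ i, x i ∈ box 3 n) ∧ (∀ i, ω ∈ percolatesAt (x i)) ∧
        ∀ i j, i ≠ j → ω ∉ openConnIn (↑(box 3 (k * n)) : Set (Site 3)) (x i) (x j)} := by
  obtain ⟨M, c, hc, hfreq⟩ := hS1
  refine ⟨M, c, hc, hfreq.mono fun n hn => hn.trans (measureReal_mono ?_ (measure_ne_top _ _))⟩
  rintro ω hω ⟨x, hxbox, hperc, hbad⟩
  refine hω ⟨x, hxbox, hperc, fun i j hij hc2 => hbad i j hij ?_⟩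
  rw [DCT16.mem_openConnIn_iff_pathIn] at hc2 ⊢
  exact hc2.mono (Finset.coe_subset.2 (box_mono 3 (by nlinarith)))

open scoped Classical in
/-- **The route decides the summit from S1 at any fixed ratio `k ≥ 1`:**
`FreeBoxSparse → S1(ratio k) → θ(p_c(ℤ³)) = 0`, over the landed supports `densityWhp_proof`, the counting lemma
`sq_card_le_mul_card_filter_of_not_exists` (with `good :=` "percolates") and the abstract assembly
`nonProlifAssembly_abstract` / `nonProlifAssembly_markov`, with `FreeBoxSparse` read at index `k n` and
`|B(k n)|² ≤ k⁶ |B(n)|²`. -/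
theorem continuity_of_freeBoxSparse_of_fewClassesRatio :
    Summit.CriticalPhenomena.PercolationContinuityZ3.Theses.PercNonProliferation.FreeBoxSparse →
    (∃ (k M : ℕ) (c : ℝ), 1 ≤ k ∧ 0 < c ∧ ∃ᶠ n : ℕ in atTop, c ≤ (bondPercolation (zdGraph 3) (criticalProbI 3)).real
      {ω | ¬ ∃ x : Fin (M + 1) → Site 3, (∀ i, x i ∈ box 3 n) ∧ (∀ i, ω ∈ percolatesAt (x i)) ∧
        ∀ i j, i ≠ j → ω ∉ openConnIn (↑(box 3 (k * n)) : Set (Site 3)) (x i) (x j)}) →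
    _root_.PercolationContinuityZ3 := by
  intro hSparse hS1
  unfold FreeBoxSparse at hSparse
  refine Literature.Probability.Percolation.percolationContinuityZ3_iff.2 ?_
  by_contra hne
  have theta_nonneg : 0 ≤ theta (zdGraph 3) (0 : Site 3) (criticalProbI 3) := by
    unfold theta
    exact measureReal_nonneg
  have hθ : 0 < theta (zdGraph 3) (0 : Site 3) (criticalProbI 3) := lt_of_le_of_ne theta_nonneg (Ne.symm hne)
  obtain ⟨k, M, c, hk, hc, hfreq⟩ := hS1
  have hkn : ∀ n : ℕ, n ≤ k * n := fun n => by nlinarith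
  have hD := densityWhp_proof (criticalProbI 3)
  have hK : ∀ n : ℕ, (0 : ℝ) < ((box 3 n).card : ℝ) := fun n =>
    Nat.cast_pos.2 (Finset.card_pos.2 (box_nonempty 3 n))
  have hA : (bondPercolation (zdGraph 3) (criticalProbI 3)).real (Set.univ : Set (BondConfig (Site 3)))ᶜ = 0 := by
    simp
  have hVm : ∀ n : ℕ, Measurable fun ω : BondConfig (Site 3) =>
      ((((box 3 n).filter fun x => ω ∈ percolatesAt x).card : ℕ) : ℝ) := fun n =>
    nonProlifAssembly_measurable_card_filter (box 3 n) (fun x => percolatesAt x)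
      (fun x => measurableSet_percolatesAt_holds x)
  have hSI : ∀ n : ℕ, Integrable (fun ω : BondConfig (Site 3) =>
      ((((box 3 n ×ˢ box 3 n).filter fun q => ω ∈ openConnIn ↑(box 3 (k * n)) q.1 q.2).card : ℕ) : ℝ))
        (bondPercolation (zdGraph 3) (criticalProbI 3)) ∧
      ∫ ω, ((((box 3 n ×ˢ box 3 n).filter fun q => ω ∈ openConnIn ↑(box 3 (k * n)) q.1 q.2).card : ℕ) : ℝ)
        ∂(bondPercolation (zdGraph 3) (criticalProbI 3)) =
      ∑ q ∈ box 3 n ×ˢ box 3 n, (bondPercolation (zdGraph 3) (criticalProbI 3)).real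
        (openConnIn ↑(box 3 (k * n)) q.1 q.2) := fun n =>
    nonProlifAssembly_integral_card_filter (bondPercolation (zdGraph 3) (criticalProbI 3)) (box 3 n ×ˢ box 3 n)
      (fun q : Site 3 × Site 3 => openConnIn (↑(box 3 (k * n)) : Set (Site 3)) q.1 q.2)
      (fun q => measurableSet_openConnIn_of_countable _ _ _)
  have h2n : Tendsto (fun n : ℕ => k * n) atTop atTop :=
    tendsto_atTop_mono hkn tendsto_id
  have hu : Tendsto (fun n : ℕ => ((k : ℝ) ^ 6) * ((∑ x ∈ box 3 (k * n), ∑ y ∈ box 3 (k * n),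
      (bondPercolation (zdGraph 3) (criticalProbI 3)).real (openConnIn ↑(box 3 (k * n)) x y)) /
        ((box 3 (k * n)).card : ℝ) ^ 2)) atTop (𝓝 0) := by
    have h := (hSparse.comp h2n).const_mul ((k : ℝ) ^ 6)
    rw [mul_zero] at h
    exact h
  have hES : ∀ n : ℕ,
      ∫ ω, ((((box 3 n ×ˢ box 3 n).filter fun q => ω ∈ openConnIn ↑(box 3 (k * n)) q.1 q.2).card : ℕ) : ℝ)
        ∂(bondPercolation (zdGraph 3) (criticalProbI 3)) ≤
      ((k : ℝ) ^ 6) * ((∑ x ∈ box 3 (k * n), ∑ y ∈ box 3 (k * n),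
        (bondPercolation (zdGraph 3) (criticalProbI 3)).real (openConnIn ↑(box 3 (k * n)) x y)) /
          ((box 3 (k * n)).card : ℝ) ^ 2) * ((box 3 n).card : ℝ) ^ 2 := by
    intro n
    rw [(hSI n).2, Finset.sum_product]
    have hT0 : 0 ≤ ∑ x ∈ box 3 (k * n), ∑ y ∈ box 3 (k * n),
        (bondPercolation (zdGraph 3) (criticalProbI 3)).real (openConnIn ↑(box 3 (k * n)) x y) :=
      Finset.sum_nonneg fun x _ => Finset.sum_nonneg fun y _ => measureReal_nonneg
    have hc2 : ((box 3 (k * n)).card : ℝ) ^ 2 ≠ 0 := (pow_pos (hK (k * n)) 2).ne'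
    calc ∑ x ∈ box 3 n, ∑ y ∈ box 3 n,
          (bondPercolation (zdGraph 3) (criticalProbI 3)).real (openConnIn ↑(box 3 (k * n)) x y)
        ≤ ∑ x ∈ box 3 (k * n), ∑ y ∈ box 3 (k * n),
          (bondPercolation (zdGraph 3) (criticalProbI 3)).real (openConnIn ↑(box 3 (k * n)) x y) :=
          polynomialAssembly_sum_sum_mono (box_mono 3 (hkn n)) fun x y => measureReal_nonneg
      _ = (∑ x ∈ box 3 (k * n), ∑ y ∈ box 3 (k * n),
          (bondPercolation (zdGraph 3) (criticalProbI 3)).real (openConnIn ↑(box 3 (k * n)) x y)) /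
            ((box 3 (k * n)).card : ℝ) ^ 2 * ((box 3 (k * n)).card : ℝ) ^ 2 :=
          (div_mul_cancel₀ _ hc2).symm
      _ ≤ (∑ x ∈ box 3 (k * n), ∑ y ∈ box 3 (k * n),
          (bondPercolation (zdGraph 3) (criticalProbI 3)).real (openConnIn ↑(box 3 (k * n)) x y)) /
            ((box 3 (k * n)).card : ℝ) ^ 2 * (((k : ℝ) ^ 6) * ((box 3 n).card : ℝ) ^ 2) :=
          mul_le_mul_of_nonneg_left (card_box_mul_sq_le hk n) (div_nonneg hT0 (sq_nonneg _))
      _ = _ := by ring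
  have hS : ∀ δ : ℝ, 0 < δ → Tendsto (fun n : ℕ => (bondPercolation (zdGraph 3) (criticalProbI 3)).real
      {ω : BondConfig (Site 3) | δ * ((box 3 n).card : ℝ) ^ 2 ≤
        ((((box 3 n ×ˢ box 3 n).filter fun q => ω ∈ openConnIn ↑(box 3 (k * n)) q.1 q.2).card : ℕ) : ℝ)})
      atTop (𝓝 0) := fun δ hδ =>
    nonProlifAssembly_markov (bondPercolation (zdGraph 3) (criticalProbI 3)) hK (fun n ω => Nat.cast_nonneg _)
      (fun n => (hSI n).1) hES hu hδ
  refine nonProlifAssembly_abstract (bondPercolation (zdGraph 3) (criticalProbI 3)) (M := M) hθ hc hK hA hfreq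
    (V := fun n ω => ((((box 3 n).filter fun x => ω ∈ percolatesAt x).card : ℕ) : ℝ)) ?_
    (fun n => measurableSet_le measurable_const (hVm n)) hD hS
  intro n ω _ hωG
  have hsub : box 3 n ⊆ box 3 (k * n) := box_mono 3 (hkn n)
  have hcount := sq_card_le_mul_card_filter_of_not_exists (box 3 n)
    ((box 3 n).filter fun x => ω ∈ percolatesAt x)
    (fun x y => ω ∈ openConnIn (↑(box 3 (k * n)) : Set (Site 3)) x y)
    (fun x => ω ∈ percolatesAt x) M (Finset.filter_subset _ _) ?_ ?_ ?_ ?_ hωG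
  · exact_mod_cast hcount
  · intro x hx
    have hxS : x ∈ (↑(box 3 (k * n)) : Set (Site 3)) :=
      Finset.mem_coe.2 (hsub (Finset.mem_filter.1 hx).1)
    exact ⟨hxS, hxS, SimpleGraph.Reachable.refl _⟩
  · rintro x y ⟨hx, hy, h⟩
    exact ⟨hy, hx, h.symm⟩
  · rintro x y z ⟨hx, hy, h⟩ ⟨_, hz, h'⟩
    exact ⟨hx, hz, h.trans h'⟩
  · intro x hx
    exact (Finset.mem_filter.1 hx).2

end Summit.CriticalPhenomena.PercolationContinuityZ3.Theorems.NonProliferation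

end
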